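/-
Copyright: statement-level skeleton of a published paper (lit-balaban cell, Phase-2 proof seat p39 gen 12). No proof claims
beyond what the kernel checks below.
-/
import Literature.MathematicalPhysics.QuantumFieldTheory.Balaban1983to89.B3WTFreeWick

/-!
# B3 — T. Bałaban, *(Higgs)₂,₃ quantum fields in a finite volume. III. Renormalization*, CMP **88** (1983) 411–445
[Balaban1983Higgs3], (2.25)/(2.26) p. 431 [PDF 21]: **THE WARD–TAKAHASHI IDENTITIES (2.25) AND (2.26) AT FREE BOUNDARY
CONDITIONS WITH THEIR GAUSSIAN LEFT MEMBERS** — on the infinite lattice `ηℤ^d`, for the infinite-volume Gaussian measure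
`dμ_{C^η_{M²}}` of `B3WTFreeMeasure` (Kolmogorov extension), PROVED: `∫dμ_{C^η_{M²}}⟨∂^ηφ,∂^ηλqφ⟩ = 0` (2.25) and
`∫dμ_{C^η_{M²}}[(−e⟨∂^ηφ,Bqφ⟩)(:⟨∂^ηφ,∂^ηλqφ⟩:) − e⟨φ,B·∂^ηλq²φ⟩ − ηe⟨∂^ηφ,B∂^ηλq²φ⟩]` = the four printed trace terms = `0` (2.26),
for every `d`, `N`, spacing `η > 0`, mass `M² > 0`, finitely supported external vector field `B` and gauge function `λ` (file 3/3
of the free-boundary Gaussian programme of this seat; 1/3 = `B3WTFreeMeasure`, 2/3 = `B3WTFreeWick`)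

statement-level skeleton of published theorems with citation tags; proofs where landed; nothing here is a claim about
the Yang–Mills mass gap

PDF held: `paper:balaban1983-higgs-2-3-quantum-fields-finite-volume` (journal page = PDF page + 410); pp. 430–431 [PDF 20–21] read
on the ×2 renders `run/shared/lean/pub/pub-balaban/b2b-balaban-ref1/pages/1983-cmp88-higgs23-III/1983-cmp88-higgs23-III-p020-x2.png`,
`-p021-x2.png`.

CITATION HEADER (lean-in-tree rule).  Part of the lit-balaban TYPED SKELETON (HOME `run/shared/lean/pub/lit-balaban/`), PHASE 2,
proof seat p39 (generation 12).  Rows **B3.Eq2.24-2.25** ((2.25)) and **B3.Eq2.26-2.28** ((2.26)) of `HOME/lit-balaban-r15/ROWS-B3.md`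
(fold owner r15).  Companions: this seat's torus chain `B3WT223Instance` … `B3WT226Traces` ((2.23)–(2.26) for the concrete model
on the FINITE torus, Gaussian density `Z⁻¹e^{−½⟨φ,(−Δ^η+M²)φ⟩}dφ`; this file transcribes its pairings `curJ`/`pairD`/`locQ`/`derQ`,
its normal ordering `normOrd` and its assembly `eq226_wick`/`eq226` to the infinite lattice), the gen-11 file
`B3WT226FreeLattice` (the RIGHT member of (2.26) at free boundary conditions: kernels `kerCDZ`/`kerDCDZ`, terms `wt1`–`wt4`,
`bracket226_eq_zero`, `eq226_free_CetaM`, the propagator `CetaM`), and files 1/3, 2/3 of this generation (`B3WTFreeMeasure`: the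
measure `freeMeasure`; `B3WTFreeWick`: the field insertions `fld`, `integral_inner_fld_op`, the `q`-contraction
`integral_inner_q_inner_q`).

THE PRINTED TEXT (verbatim, p. 431 [PDF 21]).  *"Taking F = 1, A = 0, we get ∫dμ_{C^η_{M²}}(φ)⟨∂^ηφ, ∂^ηλqφ⟩ = 0. (2.25)
Taking F = 1, differentiating with respect to A and next taking A = 0 and using the identity (2.25), we get
∫dμ_{C^η_{M²}}(φ)[(−e_k⟨∂^ηφ, Aqφ⟩)(:⟨∂^ηφ, ∂^ηλqφ⟩:) − e_k⟨φ, A·∂^ηλq²φ⟩ − e_k⟨∂^ηφ, ηA∂^ηλq²φ⟩]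
= −e_kΣ_{b,b′}η^{2d}A_b tr q(C^η_{M²}∂^{η*})(b₋,b′)q(C^η_{M²}∂^{η*})(b′₋,b)(∂^ηλ)(b′) + e_kΣ_{b,b′}η^{2d}A_b tr qC^η_{M²}(b₋,b′₋)
q(∂^ηC^η_{M²}∂^{η*})(b′,b)(∂^ηλ)(b′) − e_kΣ_bη^dA_b(∂^ηλ)(b) tr q²C^η_{M²}(0) − e_kΣ_bη^dηA_b(∂^ηλ)(b) tr q²(C^η_{M²}∂^η)(b₋,b) = 0, (2.26)
… where now the propagators are C^η_{M²}. … Taking other functions F, or differentiating (2.24) to higher order in A, we can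
get all necessary Ward-Takahashi identities. They hold for free boundary conditions also by taking a limit of the identities
with periodic boundary conditions."*

WHAT IS TYPED / PROVED (`d`, `N` arbitrary; `η > 0`, `M² > 0`; integer coordinates `ZSite d` for the sites of `ηℤ^d`, a bond
`b = (x, μ)` with `b₋ = x`, `b₊ = x + e_μ`; `μ = B3WTFreeMeasure.freeMeasure d N η M²`; the external vector field `B` (print: `A`)
and the gauge function `λ` enter through the bonds based in a finite WINDOW `S ⊂ ℤ^d` — at free boundary conditions the
external legs are finitely supported; charge `e = C.e` of the model's `HiggsLattice.ChargeData` (print `e_k = e(L^kε)`; the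
torus files' `cη·e` has `cη = 1` here), antisymmetric charge matrix `q = C.q`):
* §1 the printed pairings on `ηℤ^d` (the torus file's definitions transcribed): `curJ` = `⟨∂^ηφ,Bqφ⟩`, `pairD` = `⟨∂^ηφ,∂^ηλqφ⟩`,
  `locQ` = `⟨φ,B·∂^ηλq²φ⟩`, `derQ` = `⟨∂^ηφ,B∂^ηλq²φ⟩` (sums over the bonds based in `S`), `normOrd` (`:X: = X − ∫Xdμ`);
* §2 their expansions into elementary contractions `⟪φ(x),qφ(y)⟫`, `⟪φ(x),q²φ(y)⟫` (`⟪u,qu⟫ = 0`);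
* §3 the Gaussian evaluations: `trE_q` (`tr q = 0`), **`eq225_free`** — (2.25) AT FREE BOUNDARY CONDITIONS: `∫⟨∂^ηφ,∂^ηλqφ⟩dμ = 0`
  (every window, every `λ`), hence `normOrd_pairD` (*"using the identity (2.25)"*); `integral_curJ_mul_pairD` (two-propagator
  terms via the `q`-contraction), `integral_locQ` (`C^η_{M²}(0)·tr q²`), `integral_derQ` (`(C^η_{M²}∂^η)(b₋,b)·tr q²`);
* §4 **`eq226_free_wick`**: the Gaussian integral of the printed left integrand EQUALS the four printed trace terms (with the
  gen-11 kernels `kerCDZ`/`kerDCDZ` and terms `wt3`/`wt4`, the `b′`-sums `wt1S`/`wt2S` running over the window; `wt1S_eq_wt1`,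
  `wt2S_eq_wt2` when `∂^ηλ` vanishes off the window), and **`eq226_free_gaussian`**: for `λ` of polynomial growth with `∂^ηλ`
  supported in the bonds based in `S`, the left member `= eΣ_bη^dB_b tr q²·bracket226 = 0` by `B3WT226FreeLattice.eq226_free_CetaM`
  — **(2.26) AT FREE BOUNDARY CONDITIONS WITH BOTH MEMBERS**; `eq226_free_gaussian_of_support` (finitely supported `λ`: any window
  `S ⊇ supp λ ∪ ⋃_ν(supp λ − e_ν)` works).
GENERALITY: every §3–§4 evaluation up to `eq226_free_wick_bracket` is proved for the Gaussian field `dμ_C = B3WTFreeWick.kernelMeasure`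
of ANY positive semidefinite colour-diagonal kernel `δ_{ab}C(x − y)` (suffix `K`, hypothesis `hK`; `C` even where the two-propagator
bookkeeping needs it) — the free measure is the instance `C = C^η_{M²}` (statements as first landed), the `L`-periodic Gaussian
fields `dμ_{C_L}` of `B3WTPeriodicMeasure` (the torus measures read on `ℤ^d`) are the other instances: this is what makes the
print's *"limit of the identities with periodic boundary conditions"* available for the Gaussian LEFT members.
HONEST SCOPE: (i) the identities are evaluated, as printed, by *"calculating the Gaussian integrals"* (Wick) and the vanishing of
the explicit right member; the print's DERIVATION of the left member of (2.26) as the `A`-derivative of (2.24) (gauge covariance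
(2.23) of the `A`-dependent Gaussian measures) is replayed on the torus only (`B3WT223Instance`/`B3WT224Instance`/
`B3WT226Derivative`), not for `A`-dependent infinite-volume measures; (ii) the infinite-volume measure is the intrinsic one of
`B3WTFreeMeasure` (centred Gaussian, covariance `δ_{ab}C^η_{M²}(x − y)`), not shown to be the limit of the torus measures — the
print's *"limit of the identities with periodic boundary conditions"* is replayed for the right member in `B3WT226PeriodicLimit`;
(iii) external legs finitely supported; (2.27)/(2.28) (pictures) not typed.  Mathlib + the cited tree files only; definitions
with bodies and theorems, no named fact (`def … : Prop`), no `sorry`; standard axioms.  Unit `lit-balaban-p39-g12` (Phase-2 proof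
seat p39, gen 12), HOME `run/shared/lean/pub/lit-balaban/`, 2026-08-22.
-/

noncomputable section

open scoped BigOperators InnerProductSpace
open MeasureTheory ProbabilityTheory Finset

namespace Literature.MathematicalPhysics.QuantumFieldTheory.Balaban1983to89.B3WT226FreeGaussian

open B3Sect3VectorSelfEnergy B3CxiPropagator B3WT226FreeLattice B3WTFreeMeasure B3WTFreeWick
open B3WTCovariance (trE)
open B3WTWick B3WT226Pairings
open Literature.MathematicalPhysics.QuantumFieldTheory

variable {d N : ℕ} (C : HiggsLattice.ChargeData N) (η : ℝ) {Cv : ZSite d → ℝ} {M2 : ℝ}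

/-! ## §1 The pairings of (2.25)/(2.26) on the infinite lattice `ηℤ^d` (finitely supported external legs: window `S`) -/

/-- `(∂^ηφ)(b) = η⁻¹(φ(b₊) − φ(b₋))` for the bond `b = (x, μ)`, `b₋ = x`, `b₊ = x + e_μ`. [cite: Balaban1983Higgs3, (2.25) p.431] -/
def gradF (η : ℝ) (ω : Cfg d N) (x : ZSite d) (μ : Fin d) : EuclideanSpace ℝ (Fin N) :=
  η⁻¹ • (fld ω (x + unitVec μ) - fld ω x)

/-- `⟨∂^ηφ, Bqφ⟩ := Σ_b η^d⟪(∂^ηφ)(b), B_b·qφ(b₊)⟫` over the bonds `b = (x, μ)`, `x ∈ S` — the first pairing of (2.26) for an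
external vector field `B` (print: `A`) supported in the window `S` (the torus file's `B3WT226Pairings.curJ`).
[cite: Balaban1983Higgs3, (2.26) p.431] -/
def curJ (S : Finset (ZSite d)) (B : ZSite d → Fin d → ℝ) (ω : Cfg d N) : ℝ :=
  ∑ x ∈ S, ∑ μ : Fin d, η ^ d * ⟪gradF η ω x μ, B x μ • C.q (fld ω (x + unitVec μ))⟫_ℝ

/-- `⟨∂^ηφ, ∂^ηλqφ⟩ := Σ_b η^d⟪(∂^ηφ)(b), (∂^ηλ)(b)·qφ(b₊)⟫` over the bonds based in `S` — the pairing of (2.25) (the torus file's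
`B3WT224Instance.pairD`); for `λ` with `∂^ηλ` supported in the bonds based in `S` this is the full pairing.
[cite: Balaban1983Higgs3, (2.25) p.431] -/
def pairD (S : Finset (ZSite d)) (lam : ZSite d → ℝ) (ω : Cfg d N) : ℝ :=
  ∑ x ∈ S, ∑ μ : Fin d, η ^ d * ⟪gradF η ω x μ, pdiffZ η⁻¹ μ lam x • C.q (fld ω (x + unitVec μ))⟫_ℝ

/-- `⟨φ, B·∂^ηλq²φ⟩ := Σ_b η^dB_b(∂^ηλ)(b)⟪φ(b₋), q²φ(b₋)⟫` — the second pairing of (2.26) (the torus file's `locQ`).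
[cite: Balaban1983Higgs3, (2.26) p.431] -/
def locQ (S : Finset (ZSite d)) (B : ZSite d → Fin d → ℝ) (lam : ZSite d → ℝ) (ω : Cfg d N) : ℝ :=
  ∑ x ∈ S, ∑ μ : Fin d, η ^ d * (B x μ * pdiffZ η⁻¹ μ lam x * ⟪fld ω x, C.q (C.q (fld ω x))⟫_ℝ)

/-- `⟨∂^ηφ, B∂^ηλq²φ⟩ := Σ_b η^dB_b(∂^ηλ)(b)⟪(∂^ηφ)(b), q²φ(b₋)⟫` — the third pairing of (2.26) (the print carries the extra factor `η`
outside: `⟨∂^ηφ, ηA∂^ηλq²φ⟩`; the torus file's `derQ`). [cite: Balaban1983Higgs3, (2.26) p.431] -/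
def derQ (S : Finset (ZSite d)) (B : ZSite d → Fin d → ℝ) (lam : ZSite d → ℝ) (ω : Cfg d N) : ℝ :=
  ∑ x ∈ S, ∑ μ : Fin d, η ^ d * (B x μ * pdiffZ η⁻¹ μ lam x * ⟪gradF η ω x μ, C.q (C.q (fld ω x))⟫_ℝ)

omit C in
/-- **normal (Wick) ordering** with respect to `dμ_{C^η_{M²}}` at free boundary conditions: `:X: = X − ∫X dμ_{C^η_{M²}}` (the
torus file's `B3WT226Derivative.normOrd`). [cite: Balaban1983Higgs3, (2.26) p.431] -/
def normOrd (μ : Measure (Cfg d N)) (X : Cfg d N → ℝ) (ω : Cfg d N) : ℝ := X ω - ∫ ψ, X ψ ∂μ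

/-! ## §2 The pairings as sums of elementary contractions -/

/-- `⟨∂^ηφ, Bqφ⟩ = −Σ_b η^dB_bη⁻¹⟪φ(b₋), qφ(b₊)⟫` (`⟪u,qu⟫ = 0`). [cite: Balaban1983Higgs3, (2.26) p.431] -/
theorem curJ_expand (S : Finset (ZSite d)) (B : ZSite d → Fin d → ℝ) (ω : Cfg d N) :
    curJ C η S B ω = ∑ x ∈ S, ∑ μ : Fin d, -(η ^ d * B x μ * η⁻¹) * ⟪fld ω x, C.q (fld ω (x + unitVec μ))⟫_ℝ := by
  unfold curJ
  refine Finset.sum_congr rfl fun x _ => Finset.sum_congr rfl fun μ _ => ?_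
  rw [gradF, real_inner_smul_left, real_inner_smul_right, inner_sub_left, inner_q_self]
  ring

/-- `⟨∂^ηφ, ∂^ηλqφ⟩ = −Σ_b η^d(∂^ηλ)(b)η⁻¹⟪φ(b₋), qφ(b₊)⟫`. [cite: Balaban1983Higgs3, (2.25) p.431] -/
theorem pairD_expand (S : Finset (ZSite d)) (lam : ZSite d → ℝ) (ω : Cfg d N) :
    pairD C η S lam ω = ∑ x ∈ S, ∑ μ : Fin d, -(η ^ d * pdiffZ η⁻¹ μ lam x * η⁻¹) * ⟪fld ω x, C.q (fld ω (x + unitVec μ))⟫_ℝ := by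
  unfold pairD
  refine Finset.sum_congr rfl fun x _ => Finset.sum_congr rfl fun μ _ => ?_
  rw [gradF, real_inner_smul_left, real_inner_smul_right, inner_sub_left, inner_q_self]
  ring

/-- the product `⟨∂^ηφ,Bqφ⟩⟨∂^ηφ,∂^ηλqφ⟩` as a double sum of products of contractions. [cite: Balaban1983Higgs3, (2.26) p.431] -/
theorem curJ_mul_pairD_expand (S : Finset (ZSite d)) (B : ZSite d → Fin d → ℝ) (lam : ZSite d → ℝ) (ω : Cfg d N) :
    curJ C η S B ω * pairD C η S lam ω = ∑ x ∈ S, ∑ μ : Fin d, ∑ x' ∈ S, ∑ ν : Fin d,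
      (η ^ d * B x μ * η⁻¹) * (η ^ d * pdiffZ η⁻¹ ν lam x' * η⁻¹) *
        (⟪fld ω x, C.q (fld ω (x + unitVec μ))⟫_ℝ * ⟪fld ω x', C.q (fld ω (x' + unitVec ν))⟫_ℝ) := by
  rw [curJ_expand, pairD_expand, Finset.sum_mul]
  refine Finset.sum_congr rfl fun x _ => ?_
  rw [Finset.sum_mul]
  refine Finset.sum_congr rfl fun μ _ => ?_
  rw [Finset.mul_sum]
  refine Finset.sum_congr rfl fun x' _ => ?_
  rw [Finset.mul_sum]
  refine Finset.sum_congr rfl fun ν _ => ?_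
  ring

/-- `⟨∂^ηφ, B∂^ηλq²φ⟩ = Σ_b η^dB_b(∂^ηλ)(b)(η⁻¹⟪φ(b₊),q²φ(b₋)⟫ − η⁻¹⟪φ(b₋),q²φ(b₋)⟫)`. [cite: Balaban1983Higgs3, (2.26) p.431] -/
theorem derQ_expand (S : Finset (ZSite d)) (B : ZSite d → Fin d → ℝ) (lam : ZSite d → ℝ) (ω : Cfg d N) :
    derQ C η S B lam ω = ∑ x ∈ S, ∑ μ : Fin d,
      ((η ^ d * (B x μ * pdiffZ η⁻¹ μ lam x) * η⁻¹) * ⟪fld ω (x + unitVec μ), C.q (C.q (fld ω x))⟫_ℝ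
        - (η ^ d * (B x μ * pdiffZ η⁻¹ μ lam x) * η⁻¹) * ⟪fld ω x, C.q (C.q (fld ω x))⟫_ℝ) := by
  unfold derQ
  refine Finset.sum_congr rfl fun x _ => Finset.sum_congr rfl fun μ _ => ?_
  rw [gradF, real_inner_smul_left, inner_sub_left]
  ring

omit C in
/-- measurability of the elementary contraction `ω ↦ ⟪φ(x), Qφ(y)⟫` (expand in the coordinate basis). [cite: Balaban1983Higgs3, (2.26) p.431] -/
@[fun_prop]
theorem measurable_inner_fld_op (x y : ZSite d) (Q : EuclideanSpace ℝ (Fin N) →L[ℝ] EuclideanSpace ℝ (Fin N)) :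
    Measurable fun ω : Cfg d N => ⟪fld ω x, Q (fld ω y)⟫_ℝ := by
  set e := EuclideanSpace.basisFun (Fin N) ℝ with he
  have hexp : (fun ω : Cfg d N => ⟪fld ω x, Q (fld ω y)⟫_ℝ) = fun ω =>
      ∑ i : Fin N, ⟪fld ω x, e i⟫_ℝ * ⟪fld ω y, (ContinuousLinearMap.adjoint Q) (e i)⟫_ℝ := by
    funext ω
    rw [← e.sum_inner_mul_inner (fld ω x) (Q (fld ω y))]
    refine Finset.sum_congr rfl fun i _ => ?_
    rw [← ContinuousLinearMap.adjoint_inner_left, real_inner_comm (fld ω y)]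
  rw [hexp]
  exact Finset.measurable_sum _ fun i _ => (measurable_inner_fld x _).mul (measurable_inner_fld y _)

/-- the pairing `⟨∂^ηφ, Bqφ⟩` is measurable. [cite: Balaban1983Higgs3, (2.26) p.431] -/
@[fun_prop]
theorem measurable_curJ (S : Finset (ZSite d)) (B : ZSite d → Fin d → ℝ) : Measurable (curJ C η S B : Cfg d N → ℝ) := by
  have h : (curJ C η S B : Cfg d N → ℝ) = fun ω => ∑ x ∈ S, ∑ μ : Fin d,
      -(η ^ d * B x μ * η⁻¹) * ⟪fld ω x, C.q (fld ω (x + unitVec μ))⟫_ℝ := funext (curJ_expand C η S B)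
  rw [h]
  exact Finset.measurable_sum _ fun x _ => Finset.measurable_sum _ fun μ _ => (measurable_inner_fld_op _ _ _).const_mul _

/-- the pairing `⟨∂^ηφ, ∂^ηλqφ⟩` is measurable. [cite: Balaban1983Higgs3, (2.25) p.431] -/
@[fun_prop]
theorem measurable_pairD (S : Finset (ZSite d)) (lam : ZSite d → ℝ) : Measurable (pairD C η S lam : Cfg d N → ℝ) := by
  have h : (pairD C η S lam : Cfg d N → ℝ) = fun ω => ∑ x ∈ S, ∑ μ : Fin d,
      -(η ^ d * pdiffZ η⁻¹ μ lam x * η⁻¹) * ⟪fld ω x, C.q (fld ω (x + unitVec μ))⟫_ℝ := funext (pairD_expand C η S lam)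
  rw [h]
  exact Finset.measurable_sum _ fun x _ => Finset.measurable_sum _ fun μ _ => (measurable_inner_fld_op _ _ _).const_mul _

/-- the pairing `⟨φ, B·∂^ηλq²φ⟩` is measurable. [cite: Balaban1983Higgs3, (2.26) p.431] -/
@[fun_prop]
theorem measurable_locQ (S : Finset (ZSite d)) (B : ZSite d → Fin d → ℝ) (lam : ZSite d → ℝ) :
    Measurable (locQ C η S B lam : Cfg d N → ℝ) := by
  unfold locQ
  exact Finset.measurable_sum _ fun x _ => Finset.measurable_sum _ fun μ _ =>
    ((measurable_inner_fld_op x x (C.q.comp C.q)).const_mul _).const_mul _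

/-- the pairing `⟨∂^ηφ, B∂^ηλq²φ⟩` is measurable. [cite: Balaban1983Higgs3, (2.26) p.431] -/
@[fun_prop]
theorem measurable_derQ (S : Finset (ZSite d)) (B : ZSite d → Fin d → ℝ) (lam : ZSite d → ℝ) :
    Measurable (derQ C η S B lam : Cfg d N → ℝ) := by
  have h : (derQ C η S B lam : Cfg d N → ℝ) = fun ω => ∑ x ∈ S, ∑ μ : Fin d,
      ((η ^ d * (B x μ * pdiffZ η⁻¹ μ lam x) * η⁻¹) * ⟪fld ω (x + unitVec μ), C.q (C.q (fld ω x))⟫_ℝ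
        - (η ^ d * (B x μ * pdiffZ η⁻¹ μ lam x) * η⁻¹) * ⟪fld ω x, C.q (C.q (fld ω x))⟫_ℝ) := funext (derQ_expand C η S B lam)
  rw [h]
  exact Finset.measurable_sum _ fun x _ => Finset.measurable_sum _ fun μ _ =>
    ((measurable_inner_fld_op (x + unitVec μ) x (C.q.comp C.q)).const_mul _).sub
      ((measurable_inner_fld_op x x (C.q.comp C.q)).const_mul _)

/-! ## §3 The Gaussian evaluations under `dμ_{C^η_{M²}}` -/

/-- `tr q = 0` (antisymmetry, `⟪e_i, qe_i⟫ = 0`): the contraction of `⟨∂^ηφ, ∂^ηλqφ⟩` with itself free of partner vanishes —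
the mechanism of (2.25). [cite: Balaban1983Higgs3, (2.25) p.431] -/
theorem trE_q : trE C.q = 0 := by
  unfold trE
  exact Finset.sum_eq_zero fun i _ => inner_q_self C _

/-- (every positive semidefinite colour-diagonal kernel `δ_{ab}C(x − y)`, `dμ_C = kernelMeasure`) **(2.25) AT FREE BOUNDARY CONDITIONS**: `∫dμ_C(φ)⟨∂^ηφ, ∂^ηλqφ⟩ = 0` on the infinite lattice `ηℤ^d` (every window
`S`, every `λ`): each contraction is `C(·)·tr q = 0`. [cite: Balaban1983Higgs3, (2.25) p.431] -/
theorem eq225_freeK (hK : IsPosSemidefKernel (scalarKernel d N Cv)) (S : Finset (ZSite d)) (lam : ZSite d → ℝ) :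
    ∫ ω, pairD C η S lam ω ∂kernelMeasure d N Cv = 0 := by
  simp_rw [pairD_expand]
  rw [integral_finsetSum _ (fun x _ => integrable_finsetSum _ fun μ _ => (integrable_inner_fld_opK hK _ _ _).const_mul _)]
  refine Finset.sum_eq_zero fun x _ => ?_
  rw [integral_finsetSum _ (fun μ _ => (integrable_inner_fld_opK hK _ _ _).const_mul _)]
  refine Finset.sum_eq_zero fun μ _ => ?_
  rw [integral_const_mul, integral_inner_fld_opK hK, trE_q, mul_zero, mul_zero]

/-- (instance `C = C^η_{M²}`, the free measure) **(2.25) AT FREE BOUNDARY CONDITIONS**: `∫dμ_{C^η_{M²}}(φ)⟨∂^ηφ, ∂^ηλqφ⟩ = 0` on the infinite lattice `ηℤ^d` (every window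
`S`, every `λ`): each contraction is `C^η_{M²}(·)·tr q = 0`. [cite: Balaban1983Higgs3, (2.25) p.431] -/
theorem eq225_free (hη : 0 < η) (hM : 0 < M2) (S : Finset (ZSite d)) (lam : ZSite d → ℝ) :
    ∫ ω, pairD C η S lam ω ∂freeMeasure d N η M2 = 0 :=
  eq225_freeK C η (Cv := CetaM d η M2) (isPosSemidefKernel_freeKernel hη hM) S lam

/-- (every positive semidefinite colour-diagonal kernel `δ_{ab}C(x − y)`, `dμ_C = kernelMeasure`) *"using the identity (2.25)"*: `:⟨∂^ηφ, ∂^ηλqφ⟩: = ⟨∂^ηφ, ∂^ηλqφ⟩` under `dμ_C` at free boundary conditions.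
[cite: Balaban1983Higgs3, (2.26) p.431] -/
theorem normOrd_pairDK (hK : IsPosSemidefKernel (scalarKernel d N Cv)) (S : Finset (ZSite d)) (lam : ZSite d → ℝ) :
    normOrd (kernelMeasure d N Cv) (pairD C η S lam) = pairD C η S lam := by
  funext ω
  rw [normOrd, eq225_freeK C η hK S lam, sub_zero]

/-- (instance `C = C^η_{M²}`, the free measure) *"using the identity (2.25)"*: `:⟨∂^ηφ, ∂^ηλqφ⟩: = ⟨∂^ηφ, ∂^ηλqφ⟩` under `dμ_{C^η_{M²}}` at free boundary conditions.
[cite: Balaban1983Higgs3, (2.26) p.431] -/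
theorem normOrd_pairD (hη : 0 < η) (hM : 0 < M2) (S : Finset (ZSite d)) (lam : ZSite d → ℝ) :
    normOrd (freeMeasure d N η M2) (pairD C η S lam) = pairD C η S lam :=
  normOrd_pairDK C η (Cv := CetaM d η M2) (isPosSemidefKernel_freeKernel hη hM) S lam

/-- (every positive semidefinite colour-diagonal kernel `δ_{ab}C(x − y)`, `dμ_C = kernelMeasure`) integrability of the pairing `⟨∂^ηφ, ∂^ηλqφ⟩`. [cite: Balaban1983Higgs3, (2.25) p.431] -/
theorem integrable_pairDK (hK : IsPosSemidefKernel (scalarKernel d N Cv)) (S : Finset (ZSite d)) (lam : ZSite d → ℝ) :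
    Integrable (pairD C η S lam) (kernelMeasure d N Cv) := by
  have h : pairD C η S lam = fun ω => ∑ x ∈ S, ∑ μ : Fin d,
      -(η ^ d * pdiffZ η⁻¹ μ lam x * η⁻¹) * ⟪fld ω x, C.q (fld ω (x + unitVec μ))⟫_ℝ := funext (pairD_expand C η S lam)
  rw [h]
  exact integrable_finsetSum _ fun x _ => integrable_finsetSum _ fun μ _ => (integrable_inner_fld_opK hK _ _ _).const_mul _

/-- (instance `C = C^η_{M²}`, the free measure) integrability of the pairing `⟨∂^ηφ, ∂^ηλqφ⟩`. [cite: Balaban1983Higgs3, (2.25) p.431] -/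
theorem integrable_pairD (hη : 0 < η) (hM : 0 < M2) (S : Finset (ZSite d)) (lam : ZSite d → ℝ) :
    Integrable (pairD C η S lam) (freeMeasure d N η M2) :=
  integrable_pairDK C η (Cv := CetaM d η M2) (isPosSemidefKernel_freeKernel hη hM) S lam

/-- (every positive semidefinite colour-diagonal kernel `δ_{ab}C(x − y)`, `dμ_C = kernelMeasure`) **two-propagator terms**: `∫⟨∂^ηφ,Bqφ⟩⟨∂^ηφ,∂^ηλqφ⟩dμ_C = Σ_{b,b′}(η^dB_bη⁻¹)(η^d(∂^ηλ)(b′)η⁻¹)·tr q²·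
(C(b₋−b′₊)C(b₊−b′₋) − C(b₋−b′₋)C(b₊−b′₊))` (`B3WTFreeWick.integral_inner_q_inner_qK` for each pair of bonds).
[cite: Balaban1983Higgs3, (2.26) p.431] -/
theorem integral_curJ_mul_pairDK (hK : IsPosSemidefKernel (scalarKernel d N Cv)) (S : Finset (ZSite d)) (B : ZSite d → Fin d → ℝ)
    (lam : ZSite d → ℝ) :
    ∫ ω, curJ C η S B ω * pairD C η S lam ω ∂kernelMeasure d N Cv = ∑ x ∈ S, ∑ μ : Fin d, ∑ x' ∈ S, ∑ ν : Fin d,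
      (η ^ d * B x μ * η⁻¹) * (η ^ d * pdiffZ η⁻¹ ν lam x' * η⁻¹) * (trE (C.q.comp C.q) *
        (Cv (x - (x' + unitVec ν)) * Cv ((x + unitVec μ) - x')
          - Cv (x - x') * Cv ((x + unitVec μ) - (x' + unitVec ν)))) := by
  simp_rw [curJ_mul_pairD_expand]
  have I : ∀ (x : ZSite d) (μ : Fin d) (x' : ZSite d) (ν : Fin d), Integrable (fun ω : Cfg d N =>
      (η ^ d * B x μ * η⁻¹) * (η ^ d * pdiffZ η⁻¹ ν lam x' * η⁻¹) *
        (⟪fld ω x, C.q (fld ω (x + unitVec μ))⟫_ℝ * ⟪fld ω x', C.q (fld ω (x' + unitVec ν))⟫_ℝ)) (kernelMeasure d N Cv) :=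
    fun x μ x' ν => (integrable_inner_q_inner_qK C hK _ _ _ _).const_mul _
  rw [integral_finsetSum _ (fun x _ => integrable_finsetSum _ fun μ _ => integrable_finsetSum _ fun x' _ =>
    integrable_finsetSum _ fun ν _ => I x μ x' ν)]
  refine Finset.sum_congr rfl fun x _ => ?_
  rw [integral_finsetSum _ (fun μ _ => integrable_finsetSum _ fun x' _ => integrable_finsetSum _ fun ν _ => I x μ x' ν)]
  refine Finset.sum_congr rfl fun μ _ => ?_
  rw [integral_finsetSum _ (fun x' _ => integrable_finsetSum _ fun ν _ => I x μ x' ν)]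
  refine Finset.sum_congr rfl fun x' _ => ?_
  rw [integral_finsetSum _ (fun ν _ => I x μ x' ν)]
  refine Finset.sum_congr rfl fun ν _ => ?_
  rw [integral_const_mul, integral_inner_q_inner_qK C hK]

/-- (instance `C = C^η_{M²}`, the free measure) **two-propagator terms**: `∫⟨∂^ηφ,Bqφ⟩⟨∂^ηφ,∂^ηλqφ⟩dμ_{C^η_{M²}} = Σ_{b,b′}(η^dB_bη⁻¹)(η^d(∂^ηλ)(b′)η⁻¹)·tr q²·
(C(b₋−b′₊)C(b₊−b′₋) − C(b₋−b′₋)C(b₊−b′₊))` (`B3WTFreeWick.integral_inner_q_inner_q` for each pair of bonds).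
[cite: Balaban1983Higgs3, (2.26) p.431] -/
theorem integral_curJ_mul_pairD (hη : 0 < η) (hM : 0 < M2) (S : Finset (ZSite d)) (B : ZSite d → Fin d → ℝ)
    (lam : ZSite d → ℝ) :
    ∫ ω, curJ C η S B ω * pairD C η S lam ω ∂freeMeasure d N η M2 = ∑ x ∈ S, ∑ μ : Fin d, ∑ x' ∈ S, ∑ ν : Fin d,
      (η ^ d * B x μ * η⁻¹) * (η ^ d * pdiffZ η⁻¹ ν lam x' * η⁻¹) * (trE (C.q.comp C.q) *
        (CetaM d η M2 (x - (x' + unitVec ν)) * CetaM d η M2 ((x + unitVec μ) - x')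
          - CetaM d η M2 (x - x') * CetaM d η M2 ((x + unitVec μ) - (x' + unitVec ν)))) :=
  integral_curJ_mul_pairDK C η (Cv := CetaM d η M2) (isPosSemidefKernel_freeKernel hη hM) S B lam

/-- (every positive semidefinite colour-diagonal kernel `δ_{ab}C(x − y)`, `dμ_C = kernelMeasure`) integrability of `⟨∂^ηφ,Bqφ⟩⟨∂^ηφ,∂^ηλqφ⟩`. [cite: Balaban1983Higgs3, (2.26) p.431] -/
theorem integrable_curJ_mul_pairDK (hK : IsPosSemidefKernel (scalarKernel d N Cv)) (S : Finset (ZSite d)) (B : ZSite d → Fin d → ℝ)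
    (lam : ZSite d → ℝ) : Integrable (fun ω => curJ C η S B ω * pairD C η S lam ω) (kernelMeasure d N Cv) := by
  have h : (fun ω => curJ C η S B ω * pairD C η S lam ω) = fun ω => ∑ x ∈ S, ∑ μ : Fin d, ∑ x' ∈ S, ∑ ν : Fin d,
      (η ^ d * B x μ * η⁻¹) * (η ^ d * pdiffZ η⁻¹ ν lam x' * η⁻¹) *
        (⟪fld ω x, C.q (fld ω (x + unitVec μ))⟫_ℝ * ⟪fld ω x', C.q (fld ω (x' + unitVec ν))⟫_ℝ) :=
    funext (curJ_mul_pairD_expand C η S B lam)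
  rw [h]
  exact integrable_finsetSum _ fun x _ => integrable_finsetSum _ fun μ _ => integrable_finsetSum _ fun x' _ =>
    integrable_finsetSum _ fun ν _ => (integrable_inner_q_inner_qK C hK _ _ _ _).const_mul _

/-- (instance `C = C^η_{M²}`, the free measure) integrability of `⟨∂^ηφ,Bqφ⟩⟨∂^ηφ,∂^ηλqφ⟩`. [cite: Balaban1983Higgs3, (2.26) p.431] -/
theorem integrable_curJ_mul_pairD (hη : 0 < η) (hM : 0 < M2) (S : Finset (ZSite d)) (B : ZSite d → Fin d → ℝ)
    (lam : ZSite d → ℝ) : Integrable (fun ω => curJ C η S B ω * pairD C η S lam ω) (freeMeasure d N η M2) :=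
  integrable_curJ_mul_pairDK C η (Cv := CetaM d η M2) (isPosSemidefKernel_freeKernel hη hM) S B lam

/-- (every positive semidefinite colour-diagonal kernel `δ_{ab}C(x − y)`, `dμ_C = kernelMeasure`) **third term**: `∫⟨φ,B·∂^ηλq²φ⟩dμ_C = Σ_bη^dB_b(∂^ηλ)(b)·C(0)·tr q²`. [cite: Balaban1983Higgs3, (2.26) p.431] -/
theorem integral_locQK (hK : IsPosSemidefKernel (scalarKernel d N Cv)) (S : Finset (ZSite d)) (B : ZSite d → Fin d → ℝ) (lam : ZSite d → ℝ) :
    ∫ ω, locQ C η S B lam ω ∂kernelMeasure d N Cv =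
      ∑ x ∈ S, ∑ μ : Fin d, η ^ d * (B x μ * pdiffZ η⁻¹ μ lam x) * (Cv 0 * trE (C.q.comp C.q)) := by
  unfold locQ
  have I : ∀ (x : ZSite d) (μ : Fin d), Integrable (fun ω : Cfg d N =>
      η ^ d * (B x μ * pdiffZ η⁻¹ μ lam x * ⟪fld ω x, C.q (C.q (fld ω x))⟫_ℝ)) (kernelMeasure d N Cv) := by
    intro x μ
    have h := (integrable_inner_fld_opK hK x x (C.q.comp C.q)).const_mul (η ^ d * (B x μ * pdiffZ η⁻¹ μ lam x))
    refine h.congr (ae_of_all _ fun ω => ?_)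
    simp only [ContinuousLinearMap.comp_apply]
    ring
  rw [integral_finsetSum _ (fun x _ => integrable_finsetSum _ fun μ _ => I x μ)]
  refine Finset.sum_congr rfl fun x _ => ?_
  rw [integral_finsetSum _ (fun μ _ => I x μ)]
  refine Finset.sum_congr rfl fun μ _ => ?_
  have h : (fun ω : Cfg d N => η ^ d * (B x μ * pdiffZ η⁻¹ μ lam x * ⟪fld ω x, C.q (C.q (fld ω x))⟫_ℝ)) =
      fun ω => (η ^ d * (B x μ * pdiffZ η⁻¹ μ lam x)) * ⟪fld ω x, (C.q.comp C.q) (fld ω x)⟫_ℝ := by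
    funext ω
    simp only [ContinuousLinearMap.comp_apply]
    ring
  rw [h, integral_const_mul, integral_inner_fld_opK hK, sub_self]

/-- (instance `C = C^η_{M²}`, the free measure) **third term**: `∫⟨φ,B·∂^ηλq²φ⟩dμ_{C^η_{M²}} = Σ_bη^dB_b(∂^ηλ)(b)·C^η_{M²}(0)·tr q²`. [cite: Balaban1983Higgs3, (2.26) p.431] -/
theorem integral_locQ (hη : 0 < η) (hM : 0 < M2) (S : Finset (ZSite d)) (B : ZSite d → Fin d → ℝ) (lam : ZSite d → ℝ) :
    ∫ ω, locQ C η S B lam ω ∂freeMeasure d N η M2 =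
      ∑ x ∈ S, ∑ μ : Fin d, η ^ d * (B x μ * pdiffZ η⁻¹ μ lam x) * (CetaM d η M2 0 * trE (C.q.comp C.q)) :=
  integral_locQK C η (Cv := CetaM d η M2) (isPosSemidefKernel_freeKernel hη hM) S B lam

/-- (every positive semidefinite colour-diagonal kernel `δ_{ab}C(x − y)`, `dμ_C = kernelMeasure`) integrability of `⟨φ,B·∂^ηλq²φ⟩`. [cite: Balaban1983Higgs3, (2.26) p.431] -/
theorem integrable_locQK (hK : IsPosSemidefKernel (scalarKernel d N Cv)) (S : Finset (ZSite d)) (B : ZSite d → Fin d → ℝ) (lam : ZSite d → ℝ) :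
    Integrable (locQ C η S B lam) (kernelMeasure d N Cv) := by
  have h : locQ C η S B lam = fun ω => ∑ x ∈ S, ∑ μ : Fin d,
      (η ^ d * (B x μ * pdiffZ η⁻¹ μ lam x)) * ⟪fld ω x, (C.q.comp C.q) (fld ω x)⟫_ℝ := by
    funext ω
    unfold locQ
    refine Finset.sum_congr rfl fun x _ => Finset.sum_congr rfl fun μ _ => ?_
    simp only [ContinuousLinearMap.comp_apply]
    ring
  rw [h]
  exact integrable_finsetSum _ fun x _ => integrable_finsetSum _ fun μ _ => (integrable_inner_fld_opK hK _ _ _).const_mul _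

/-- (instance `C = C^η_{M²}`, the free measure) integrability of `⟨φ,B·∂^ηλq²φ⟩`. [cite: Balaban1983Higgs3, (2.26) p.431] -/
theorem integrable_locQ (hη : 0 < η) (hM : 0 < M2) (S : Finset (ZSite d)) (B : ZSite d → Fin d → ℝ) (lam : ZSite d → ℝ) :
    Integrable (locQ C η S B lam) (freeMeasure d N η M2) :=
  integrable_locQK C η (Cv := CetaM d η M2) (isPosSemidefKernel_freeKernel hη hM) S B lam

/-- (every positive semidefinite colour-diagonal kernel `δ_{ab}C(x − y)`, `dμ_C = kernelMeasure`) **fourth term**: `∫⟨∂^ηφ,B∂^ηλq²φ⟩dμ_C = Σ_bη^dB_b(∂^ηλ)(b)·(C∂^η)(b₋,b)·tr q²` with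
`(C∂^η)(b₋,b) = η⁻¹(C(e_μ) − C(0))` (`= B3WT226FreeLattice.kerCDZ η⁻¹ C x x μ`, `C` even). [cite: Balaban1983Higgs3, (2.26) p.431] -/
theorem integral_derQK (hK : IsPosSemidefKernel (scalarKernel d N Cv)) (hCeven : ∀ z, Cv (-z) = Cv z) (S : Finset (ZSite d)) (B : ZSite d → Fin d → ℝ) (lam : ZSite d → ℝ) :
    ∫ ω, derQ C η S B lam ω ∂kernelMeasure d N Cv =
      ∑ x ∈ S, ∑ μ : Fin d, η ^ d * (B x μ * pdiffZ η⁻¹ μ lam x) *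
        (kerCDZ η⁻¹ (Cv) x x μ * trE (C.q.comp C.q)) := by
  simp_rw [derQ_expand]
  have I1 : ∀ (x : ZSite d) (μ : Fin d), Integrable (fun ω : Cfg d N =>
      (η ^ d * (B x μ * pdiffZ η⁻¹ μ lam x) * η⁻¹) * ⟪fld ω (x + unitVec μ), C.q (C.q (fld ω x))⟫_ℝ) (kernelMeasure d N Cv) :=
    fun x μ => (integrable_inner_fld_opK hK (x + unitVec μ) x (C.q.comp C.q)).const_mul _
  have I2 : ∀ (x : ZSite d) (μ : Fin d), Integrable (fun ω : Cfg d N =>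
      (η ^ d * (B x μ * pdiffZ η⁻¹ μ lam x) * η⁻¹) * ⟪fld ω x, C.q (C.q (fld ω x))⟫_ℝ) (kernelMeasure d N Cv) :=
    fun x μ => (integrable_inner_fld_opK hK x x (C.q.comp C.q)).const_mul _
  have I : ∀ (x : ZSite d) (μ : Fin d), Integrable (fun ω : Cfg d N =>
      (η ^ d * (B x μ * pdiffZ η⁻¹ μ lam x) * η⁻¹) * ⟪fld ω (x + unitVec μ), C.q (C.q (fld ω x))⟫_ℝ
        - (η ^ d * (B x μ * pdiffZ η⁻¹ μ lam x) * η⁻¹) * ⟪fld ω x, C.q (C.q (fld ω x))⟫_ℝ) (kernelMeasure d N Cv) :=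
    fun x μ => (I1 x μ).sub (I2 x μ)
  rw [integral_finsetSum _ (fun x _ => integrable_finsetSum _ fun μ _ => I x μ)]
  refine Finset.sum_congr rfl fun x _ => ?_
  rw [integral_finsetSum _ (fun μ _ => I x μ)]
  refine Finset.sum_congr rfl fun μ _ => ?_
  rw [integral_sub (I1 x μ) (I2 x μ), integral_const_mul, integral_const_mul]
  have h1 : ∫ ω, ⟪fld ω (x + unitVec μ), C.q (C.q (fld ω x))⟫_ℝ ∂kernelMeasure d N Cv =
      Cv ((x + unitVec μ) - x) * trE (C.q.comp C.q) := integral_inner_fld_opK hK (x + unitVec μ) x (C.q.comp C.q)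
  have h2 : ∫ ω, ⟪fld ω x, C.q (C.q (fld ω x))⟫_ℝ ∂kernelMeasure d N Cv = Cv (x - x) * trE (C.q.comp C.q) :=
    integral_inner_fld_opK hK x x (C.q.comp C.q)
  rw [h1, h2, kerCDZ, sub_self, add_sub_cancel_left, show x - (x + unitVec μ) = -unitVec μ by abel, hCeven]
  ring

/-- (instance `C = C^η_{M²}`, the free measure) **fourth term**: `∫⟨∂^ηφ,B∂^ηλq²φ⟩dμ_{C^η_{M²}} = Σ_bη^dB_b(∂^ηλ)(b)·(C^η_{M²}∂^η)(b₋,b)·tr q²` with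
`(C∂^η)(b₋,b) = η⁻¹(C(e_μ) − C(0))` (`= B3WT226FreeLattice.kerCDZ η⁻¹ C x x μ`, `C` even). [cite: Balaban1983Higgs3, (2.26) p.431] -/
theorem integral_derQ (hη : 0 < η) (hM : 0 < M2) (S : Finset (ZSite d)) (B : ZSite d → Fin d → ℝ) (lam : ZSite d → ℝ) :
    ∫ ω, derQ C η S B lam ω ∂freeMeasure d N η M2 =
      ∑ x ∈ S, ∑ μ : Fin d, η ^ d * (B x μ * pdiffZ η⁻¹ μ lam x) *
        (kerCDZ η⁻¹ (CetaM d η M2) x x μ * trE (C.q.comp C.q)) :=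
  integral_derQK C η (Cv := CetaM d η M2) (isPosSemidefKernel_freeKernel hη hM) CetaM_neg S B lam

/-- (every positive semidefinite colour-diagonal kernel `δ_{ab}C(x − y)`, `dμ_C = kernelMeasure`) integrability of `⟨∂^ηφ,B∂^ηλq²φ⟩`. [cite: Balaban1983Higgs3, (2.26) p.431] -/
theorem integrable_derQK (hK : IsPosSemidefKernel (scalarKernel d N Cv)) (S : Finset (ZSite d)) (B : ZSite d → Fin d → ℝ) (lam : ZSite d → ℝ) :
    Integrable (derQ C η S B lam) (kernelMeasure d N Cv) := by
  have h : derQ C η S B lam = fun ω => ∑ x ∈ S, ∑ μ : Fin d,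
      ((η ^ d * (B x μ * pdiffZ η⁻¹ μ lam x) * η⁻¹) * ⟪fld ω (x + unitVec μ), C.q (C.q (fld ω x))⟫_ℝ
        - (η ^ d * (B x μ * pdiffZ η⁻¹ μ lam x) * η⁻¹) * ⟪fld ω x, C.q (C.q (fld ω x))⟫_ℝ) :=
    funext (derQ_expand C η S B lam)
  rw [h]
  exact integrable_finsetSum _ fun x _ => integrable_finsetSum _ fun μ _ =>
    ((integrable_inner_fld_opK hK (x + unitVec μ) x (C.q.comp C.q)).const_mul _).sub
      ((integrable_inner_fld_opK hK x x (C.q.comp C.q)).const_mul _)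

/-- (instance `C = C^η_{M²}`, the free measure) integrability of `⟨∂^ηφ,B∂^ηλq²φ⟩`. [cite: Balaban1983Higgs3, (2.26) p.431] -/
theorem integrable_derQ (hη : 0 < η) (hM : 0 < M2) (S : Finset (ZSite d)) (B : ZSite d → Fin d → ℝ) (lam : ZSite d → ℝ) :
    Integrable (derQ C η S B lam) (freeMeasure d N η M2) :=
  integrable_derQK C η (Cv := CetaM d η M2) (isPosSemidefKernel_freeKernel hη hM) S B lam

/-! ## §4 (2.26) at free boundary conditions: the Gaussian left member equals the four printed trace terms, which vanish -/

/-- the first printed term's `b′`-sum restricted to the bonds based in the window `S` (for `∂^ηλ` supported there it is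
`B3WT226FreeLattice.wt1`, `wt1S_eq_wt1`). [cite: Balaban1983Higgs3, (2.26) p.431] -/
def wt1S (S : Finset (ZSite d)) (Cfn lam : ZSite d → ℝ) (x : ZSite d) (μ : Fin d) : ℝ :=
  ∑ x' ∈ S, η ^ d * ∑ ν : Fin d, kerCDZ η⁻¹ Cfn x x' ν * kerCDZ η⁻¹ Cfn x' x μ * pdiffZ η⁻¹ ν lam x'

/-- the second printed term's `b′`-sum restricted to the window `S` (`= wt2` for `∂^ηλ` supported there, `wt2S_eq_wt2`).
[cite: Balaban1983Higgs3, (2.26) p.431] -/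
def wt2S (S : Finset (ZSite d)) (Cfn lam : ZSite d → ℝ) (x : ZSite d) (μ : Fin d) : ℝ :=
  ∑ x' ∈ S, η ^ d * ∑ ν : Fin d, Cfn (x - x') * kerDCDZ η⁻¹ Cfn x' ν x μ * pdiffZ η⁻¹ ν lam x'

omit C in
/-- for `∂^ηλ` vanishing off the bonds based in `S`, the windowed `b′`-sum is the full one. [cite: Balaban1983Higgs3, (2.26) p.431] -/
theorem wt1S_eq_wt1 (S : Finset (ZSite d)) (Cfn lam : ZSite d → ℝ) (hlamS : ∀ x, x ∉ S → ∀ ν : Fin d, pdiffZ η⁻¹ ν lam x = 0)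
    (x : ZSite d) (μ : Fin d) : wt1S η S Cfn lam x μ = wt1 η Cfn lam x μ := by
  rw [wt1, wt1S, tsum_eq_sum (s := S)]
  intro x' hx'
  rw [Finset.sum_eq_zero fun ν _ => by rw [hlamS x' hx' ν, mul_zero], mul_zero]

omit C in
/-- for `∂^ηλ` vanishing off the bonds based in `S`, the windowed `b′`-sum is the full one. [cite: Balaban1983Higgs3, (2.26) p.431] -/
theorem wt2S_eq_wt2 (S : Finset (ZSite d)) (Cfn lam : ZSite d → ℝ) (hlamS : ∀ x, x ∉ S → ∀ ν : Fin d, pdiffZ η⁻¹ ν lam x = 0)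
    (x : ZSite d) (μ : Fin d) : wt2S η S Cfn lam x μ = wt2 η Cfn lam x μ := by
  rw [wt2, wt2S, tsum_eq_sum (s := S)]
  intro x' hx'
  rw [Finset.sum_eq_zero fun ν _ => by rw [hlamS x' hx' ν, mul_zero], mul_zero]

/-- (every positive semidefinite colour-diagonal kernel `δ_{ab}C(x − y)`, `dμ_C = kernelMeasure`) **THE GAUSSIAN EVALUATION OF THE LEFT MEMBER OF (2.26) AT FREE BOUNDARY CONDITIONS**:
`∫dμ_C(φ)[(−e⟨∂^ηφ,Bqφ⟩)(:⟨∂^ηφ,∂^ηλqφ⟩:) − e⟨φ,B·∂^ηλq²φ⟩ − ηe⟨∂^ηφ,B∂^ηλq²φ⟩]`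
`= −eΣ_bη^dB_b tr q²·wt1S + eΣ_bη^dB_b tr q²·wt2S − eΣ_bη^dB_b tr q²·wt3 − eΣ_bη^dB_b tr q²·wt4` — the four printed trace terms of
(2.26) (*"calculating the Gaussian integrals"*), with the propagator `C` of the infinite lattice and the `b′`-sums over the
window `S`. [cite: Balaban1983Higgs3, (2.26) p.431] -/
theorem eq226_free_wickK (hK : IsPosSemidefKernel (scalarKernel d N Cv)) (hCeven : ∀ z, Cv (-z) = Cv z) (S : Finset (ZSite d)) (B : ZSite d → Fin d → ℝ) (lam : ZSite d → ℝ) :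
    ∫ ω, ((-C.e * curJ C η S B ω) * normOrd (kernelMeasure d N Cv) (pairD C η S lam) ω - C.e * locQ C η S B lam ω
        - (η * C.e) * derQ C η S B lam ω) ∂kernelMeasure d N Cv =
      (-C.e * ∑ x ∈ S, ∑ μ : Fin d, η ^ d * B x μ * (trE (C.q.comp C.q) * wt1S η S (Cv) lam x μ)) +
      (C.e * ∑ x ∈ S, ∑ μ : Fin d, η ^ d * B x μ * (trE (C.q.comp C.q) * wt2S η S (Cv) lam x μ)) -
      (C.e * ∑ x ∈ S, ∑ μ : Fin d, η ^ d * B x μ * (trE (C.q.comp C.q) * wt3 η (Cv) lam x μ)) -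
      (C.e * ∑ x ∈ S, ∑ μ : Fin d, η ^ d * B x μ * (trE (C.q.comp C.q) * wt4 η (Cv) lam x μ)) := by
  rw [normOrd_pairDK C η hK S lam]
  have i1 := integrable_curJ_mul_pairDK C η hK S B lam
  have i2 := integrable_locQK C η hK S B lam
  have i3 := integrable_derQK C η hK S B lam
  have hsplit : (fun ω => (-C.e * curJ C η S B ω) * pairD C η S lam ω - C.e * locQ C η S B lam ω
      - (η * C.e) * derQ C η S B lam ω) = fun ω =>
      -C.e * (curJ C η S B ω * pairD C η S lam ω) - C.e * locQ C η S B lam ω - (η * C.e) * derQ C η S B lam ω := by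
    funext ω; ring
  have j1 : Integrable (fun ω => -C.e * (curJ C η S B ω * pairD C η S lam ω)) (kernelMeasure d N Cv) := i1.const_mul _
  have j2 : Integrable (fun ω => C.e * locQ C η S B lam ω) (kernelMeasure d N Cv) := i2.const_mul _
  have j3 : Integrable (fun ω => (η * C.e) * derQ C η S B lam ω) (kernelMeasure d N Cv) := i3.const_mul _
  have j12 : Integrable (fun ω => -C.e * (curJ C η S B ω * pairD C η S lam ω) - C.e * locQ C η S B lam ω)
      (kernelMeasure d N Cv) := j1.sub j2
  rw [hsplit, integral_sub j12 j3, integral_sub j1 j2, integral_const_mul, integral_const_mul, integral_const_mul,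
    integral_curJ_mul_pairDK C η hK, integral_locQK C η hK, integral_derQK C η hK hCeven]
  set τ : ℝ := trE (C.q.comp C.q) with hτ
  set Cf : ZSite d → ℝ := Cv with hCf
  -- evenness rewrites for the two-propagator terms
  have ev : ∀ z : ZSite d, Cf (-z) = Cf z := hCeven
  have key : ∀ (x : ZSite d) (μ : Fin d) (x' : ZSite d) (ν : Fin d),
      (η ^ d * B x μ * η⁻¹) * (η ^ d * pdiffZ η⁻¹ ν lam x' * η⁻¹) * (τ *
        (Cf (x - (x' + unitVec ν)) * Cf ((x + unitVec μ) - x') - Cf (x - x') * Cf ((x + unitVec μ) - (x' + unitVec ν)))) * (-C.e) =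
      -C.e * (η ^ d * B x μ * (τ * (η ^ d * (kerCDZ η⁻¹ Cf x x' ν * kerCDZ η⁻¹ Cf x' x μ * pdiffZ η⁻¹ ν lam x'))))
        + C.e * (η ^ d * B x μ * (τ * (η ^ d * (Cf (x - x') * kerDCDZ η⁻¹ Cf x' ν x μ * pdiffZ η⁻¹ ν lam x')))) := by
    intro x μ x' ν
    have e1 : Cf ((x + unitVec μ) - x') = Cf (x' - (x + unitVec μ)) := by rw [← ev, neg_sub]
    have e2 : Cf ((x + unitVec μ) - (x' + unitVec ν)) = Cf ((x' + unitVec ν) - (x + unitVec μ)) := by rw [← ev, neg_sub]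
    have e3 : Cf (x' - x) = Cf (x - x') := by rw [← ev, neg_sub]
    have e4 : Cf ((x' + unitVec ν) - x) = Cf (x - (x' + unitVec ν)) := by rw [← ev, neg_sub]
    unfold kerCDZ kerDCDZ
    rw [e1, e2, e3, e4]
    ring
  have hA : (∑ x ∈ S, ∑ μ : Fin d, ∑ x' ∈ S, ∑ ν : Fin d,
      (η ^ d * B x μ * η⁻¹) * (η ^ d * pdiffZ η⁻¹ ν lam x' * η⁻¹) * (τ *
        (Cf (x - (x' + unitVec ν)) * Cf ((x + unitVec μ) - x') - Cf (x - x') * Cf ((x + unitVec μ) - (x' + unitVec ν))))) * (-C.e) =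
      -C.e * (∑ x ∈ S, ∑ μ : Fin d, η ^ d * B x μ * (τ * wt1S η S Cf lam x μ)) +
      C.e * (∑ x ∈ S, ∑ μ : Fin d, η ^ d * B x μ * (τ * wt2S η S Cf lam x μ)) := by
    rw [Finset.sum_mul, Finset.mul_sum, Finset.mul_sum, ← Finset.sum_add_distrib]
    refine Finset.sum_congr rfl fun x _ => ?_
    rw [Finset.sum_mul, Finset.mul_sum, Finset.mul_sum, ← Finset.sum_add_distrib]
    refine Finset.sum_congr rfl fun μ _ => ?_
    simp only [wt1S, wt2S, Finset.mul_sum, Finset.sum_mul, ← Finset.sum_add_distrib]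
    refine Finset.sum_congr rfl fun x' _ => Finset.sum_congr rfl fun ν _ => ?_
    rw [key]
  have hB : (∑ x ∈ S, ∑ μ : Fin d, η ^ d * (B x μ * pdiffZ η⁻¹ μ lam x) * (Cf 0 * τ)) * (-C.e) =
      -(C.e * ∑ x ∈ S, ∑ μ : Fin d, η ^ d * B x μ * (τ * wt3 η Cf lam x μ)) := by
    rw [Finset.sum_mul, Finset.mul_sum, ← Finset.sum_neg_distrib]
    refine Finset.sum_congr rfl fun x _ => ?_
    rw [Finset.sum_mul, Finset.mul_sum, ← Finset.sum_neg_distrib]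
    exact Finset.sum_congr rfl fun μ _ => by rw [wt3]; ring
  have hC : (∑ x ∈ S, ∑ μ : Fin d, η ^ d * (B x μ * pdiffZ η⁻¹ μ lam x) * (kerCDZ η⁻¹ Cf x x μ * τ)) * (-(η * C.e)) =
      -(C.e * ∑ x ∈ S, ∑ μ : Fin d, η ^ d * B x μ * (τ * wt4 η Cf lam x μ)) := by
    rw [Finset.sum_mul, Finset.mul_sum, ← Finset.sum_neg_distrib]
    refine Finset.sum_congr rfl fun x _ => ?_
    rw [Finset.sum_mul, Finset.mul_sum, ← Finset.sum_neg_distrib]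
    exact Finset.sum_congr rfl fun μ _ => by rw [wt4]; ring
  linear_combination hA + hB + hC

/-- (instance `C = C^η_{M²}`, the free measure) **THE GAUSSIAN EVALUATION OF THE LEFT MEMBER OF (2.26) AT FREE BOUNDARY CONDITIONS**:
`∫dμ_{C^η_{M²}}(φ)[(−e⟨∂^ηφ,Bqφ⟩)(:⟨∂^ηφ,∂^ηλqφ⟩:) − e⟨φ,B·∂^ηλq²φ⟩ − ηe⟨∂^ηφ,B∂^ηλq²φ⟩]`
`= −eΣ_bη^dB_b tr q²·wt1S + eΣ_bη^dB_b tr q²·wt2S − eΣ_bη^dB_b tr q²·wt3 − eΣ_bη^dB_b tr q²·wt4` — the four printed trace terms of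
(2.26) (*"calculating the Gaussian integrals"*), with the propagator `C^η_{M²}` of the infinite lattice and the `b′`-sums over the
window `S`. [cite: Balaban1983Higgs3, (2.26) p.431] -/
theorem eq226_free_wick (hη : 0 < η) (hM : 0 < M2) (S : Finset (ZSite d)) (B : ZSite d → Fin d → ℝ) (lam : ZSite d → ℝ) :
    ∫ ω, ((-C.e * curJ C η S B ω) * normOrd (freeMeasure d N η M2) (pairD C η S lam) ω - C.e * locQ C η S B lam ω
        - (η * C.e) * derQ C η S B lam ω) ∂freeMeasure d N η M2 =
      (-C.e * ∑ x ∈ S, ∑ μ : Fin d, η ^ d * B x μ * (trE (C.q.comp C.q) * wt1S η S (CetaM d η M2) lam x μ)) +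
      (C.e * ∑ x ∈ S, ∑ μ : Fin d, η ^ d * B x μ * (trE (C.q.comp C.q) * wt2S η S (CetaM d η M2) lam x μ)) -
      (C.e * ∑ x ∈ S, ∑ μ : Fin d, η ^ d * B x μ * (trE (C.q.comp C.q) * wt3 η (CetaM d η M2) lam x μ)) -
      (C.e * ∑ x ∈ S, ∑ μ : Fin d, η ^ d * B x μ * (trE (C.q.comp C.q) * wt4 η (CetaM d η M2) lam x μ)) :=
  eq226_free_wickK C η (Cv := CetaM d η M2) (isPosSemidefKernel_freeKernel hη hM) CetaM_neg S B lam

omit C in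
/-- bookkeeping: the four windowed trace terms combine into the per-bond bracket of `B3WT226FreeLattice`
(`bracket226 = −wt1 + wt2 − wt3 − wt4`) when `∂^ηλ` vanishes off the window. [cite: Balaban1983Higgs3, (2.26) p.431] -/
theorem fourTerms_eq_sum_bracket226 (e τ : ℝ) (S : Finset (ZSite d)) (B : ZSite d → Fin d → ℝ) (Cfn lam : ZSite d → ℝ)
    (hlamS : ∀ x, x ∉ S → ∀ ν : Fin d, pdiffZ η⁻¹ ν lam x = 0) :
    (-e * ∑ x ∈ S, ∑ μ : Fin d, η ^ d * B x μ * (τ * wt1S η S Cfn lam x μ)) +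
      (e * ∑ x ∈ S, ∑ μ : Fin d, η ^ d * B x μ * (τ * wt2S η S Cfn lam x μ)) -
      (e * ∑ x ∈ S, ∑ μ : Fin d, η ^ d * B x μ * (τ * wt3 η Cfn lam x μ)) -
      (e * ∑ x ∈ S, ∑ μ : Fin d, η ^ d * B x μ * (τ * wt4 η Cfn lam x μ)) =
      e * ∑ x ∈ S, ∑ μ : Fin d, η ^ d * B x μ * (τ * bracket226 η Cfn lam x μ) := by
  simp_rw [wt1S_eq_wt1 η S Cfn lam hlamS, wt2S_eq_wt2 η S Cfn lam hlamS, bracket226]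
  simp only [Finset.mul_sum, ← Finset.sum_add_distrib, ← Finset.sum_sub_distrib, neg_mul]
  refine Finset.sum_congr rfl fun x _ => Finset.sum_congr rfl fun μ _ => ?_
  ring

/-- (every positive semidefinite colour-diagonal kernel `δ_{ab}C(x − y)`, `dμ_C = kernelMeasure`) **the Gaussian left member of (2.26) at free boundary conditions IS `eΣ_bη^dB_b tr q²·bracket226`** — the printed right
member in the per-bond form of `B3WT226FreeLattice` (for `∂^ηλ` supported in the bonds based in the window).
[cite: Balaban1983Higgs3, (2.26) p.431] -/
theorem eq226_free_wick_bracketK (hK : IsPosSemidefKernel (scalarKernel d N Cv)) (hCeven : ∀ z, Cv (-z) = Cv z) (S : Finset (ZSite d)) (B : ZSite d → Fin d → ℝ)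
    (lam : ZSite d → ℝ) (hlamS : ∀ x, x ∉ S → ∀ ν : Fin d, pdiffZ η⁻¹ ν lam x = 0) :
    ∫ ω, ((-C.e * curJ C η S B ω) * normOrd (kernelMeasure d N Cv) (pairD C η S lam) ω - C.e * locQ C η S B lam ω
        - (η * C.e) * derQ C η S B lam ω) ∂kernelMeasure d N Cv =
      C.e * ∑ x ∈ S, ∑ μ : Fin d, η ^ d * B x μ * (trE (C.q.comp C.q) * bracket226 η (Cv) lam x μ) := by
  rw [eq226_free_wickK C η hK hCeven S B lam]
  exact fourTerms_eq_sum_bracket226 η C.e (trE (C.q.comp C.q)) S B (Cv) lam hlamS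

/-- (instance `C = C^η_{M²}`, the free measure) **the Gaussian left member of (2.26) at free boundary conditions IS `eΣ_bη^dB_b tr q²·bracket226`** — the printed right
member in the per-bond form of `B3WT226FreeLattice` (for `∂^ηλ` supported in the bonds based in the window).
[cite: Balaban1983Higgs3, (2.26) p.431] -/
theorem eq226_free_wick_bracket (hη : 0 < η) (hM : 0 < M2) (S : Finset (ZSite d)) (B : ZSite d → Fin d → ℝ)
    (lam : ZSite d → ℝ) (hlamS : ∀ x, x ∉ S → ∀ ν : Fin d, pdiffZ η⁻¹ ν lam x = 0) :
    ∫ ω, ((-C.e * curJ C η S B ω) * normOrd (freeMeasure d N η M2) (pairD C η S lam) ω - C.e * locQ C η S B lam ω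
        - (η * C.e) * derQ C η S B lam ω) ∂freeMeasure d N η M2 =
      C.e * ∑ x ∈ S, ∑ μ : Fin d, η ^ d * B x μ * (trE (C.q.comp C.q) * bracket226 η (CetaM d η M2) lam x μ) :=
  eq226_free_wick_bracketK C η (Cv := CetaM d η M2) (isPosSemidefKernel_freeKernel hη hM) CetaM_neg S B lam hlamS

variable {A : ℝ} {m : ℕ}

/-- **(2.26) AT FREE BOUNDARY CONDITIONS, BOTH MEMBERS**: for the Gaussian measure `dμ_{C^η_{M²}}` on the infinite lattice `ηℤ^d`
(every `d`, `N`, `η > 0`, `M² > 0`), every external vector field `B` on the bonds based in a window `S` and every gauge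
function `λ` of polynomial growth with `∂^ηλ` supported in those bonds,
`∫dμ_{C^η_{M²}}(φ)[(−e⟨∂^ηφ,Bqφ⟩)(:⟨∂^ηφ,∂^ηλqφ⟩:) − e⟨φ,B·∂^ηλq²φ⟩ − ηe⟨∂^ηφ,B∂^ηλq²φ⟩] = 0`:
the Gaussian evaluation `eq226_free_wick` gives the four printed trace terms, i.e. `eΣ_bη^dB_b tr q²·bracket226`, and the
per-bond bracket vanishes (`B3WT226FreeLattice.bracket226_CetaM_eq_zero`). This is the print's *"They hold for free boundary
conditions also"* for (2.26) with its GAUSSIAN LEFT MEMBER. [cite: Balaban1983Higgs3, (2.26) p.431] -/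
theorem eq226_free_gaussian (hη : 0 < η) (hM : 0 < M2) (S : Finset (ZSite d)) (B : ZSite d → Fin d → ℝ) (lam : ZSite d → ℝ)
    (hlamS : ∀ x, x ∉ S → ∀ ν : Fin d, pdiffZ η⁻¹ ν lam x = 0) (hlam : ∀ z, |lam z| ≤ A * (1 + (l1 z : ℝ)) ^ m) :
    ∫ ω, ((-C.e * curJ C η S B ω) * normOrd (freeMeasure d N η M2) (pairD C η S lam) ω - C.e * locQ C η S B lam ω
        - (η * C.e) * derQ C η S B lam ω) ∂freeMeasure d N η M2 = 0 := by
  rw [eq226_free_wick_bracket C η hη hM S B lam hlamS]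
  refine mul_eq_zero_of_right _ (Finset.sum_eq_zero fun x _ => Finset.sum_eq_zero fun μ _ => ?_)
  rw [bracket226_CetaM_eq_zero hη hM hlam x μ, mul_zero, mul_zero]

omit C in
/-- support bookkeeping: if `λ` vanishes off `T` and the window `S` contains `T` and its translates `T − e_ν`, then `∂^ηλ` vanishes
on every bond based outside `S`. [cite: Balaban1983Higgs3, (2.26) p.431] -/
theorem pdiffZ_eq_zero_off_window {T S : Finset (ZSite d)} {lam : ZSite d → ℝ} (hT : ∀ x, x ∉ T → lam x = 0) (hTS : T ⊆ S)
    (hTS' : ∀ ν : Fin d, ∀ x ∈ T, x - unitVec ν ∈ S) : ∀ x, x ∉ S → ∀ ν : Fin d, pdiffZ η⁻¹ ν lam x = 0 := by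
  intro x hx ν
  have h1 : lam x = 0 := hT x fun h => hx (hTS h)
  have h2 : lam (x + unitVec ν) = 0 := by
    refine hT _ fun h => hx ?_
    have := hTS' ν _ h
    rwa [add_sub_cancel_right] at this
  simp [pdiffZ, h1, h2]

omit C in
/-- support bookkeeping: a function vanishing off a finite set `T` is bounded by `Σ_T|λ|` (polynomial growth of degree `0`).
[cite: Balaban1983Higgs3, (2.26) p.431] -/
theorem abs_le_sum_of_support {T : Finset (ZSite d)} {lam : ZSite d → ℝ} (hT : ∀ x, x ∉ T → lam x = 0) (z : ZSite d) :
    |lam z| ≤ (∑ x ∈ T, |lam x|) * (1 + (l1 z : ℝ)) ^ (0 : ℕ) := by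
  rw [pow_zero, mul_one]
  by_cases hz : z ∈ T
  · exact Finset.single_le_sum (f := fun x => |lam x|) (fun x _ => abs_nonneg _) hz
  · rw [hT z hz, abs_zero]
    exact Finset.sum_nonneg fun x _ => abs_nonneg _

/-- **(2.26) at free boundary conditions, both members, for a finitely supported gauge function**: if `λ` vanishes off a finite
set `T` and the window `S` contains `T` and its translates `T − e_ν`, the hypotheses of `eq226_free_gaussian` hold (`∂^ηλ` is
supported in the bonds based in `S`; `|λ| ≤ Σ_{T}|λ|`). [cite: Balaban1983Higgs3, (2.26) p.431] -/
theorem eq226_free_gaussian_of_support (hη : 0 < η) (hM : 0 < M2) (T S : Finset (ZSite d)) (B : ZSite d → Fin d → ℝ)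
    (lam : ZSite d → ℝ) (hT : ∀ x, x ∉ T → lam x = 0) (hTS : T ⊆ S) (hTS' : ∀ ν : Fin d, ∀ x ∈ T, x - unitVec ν ∈ S) :
    ∫ ω, ((-C.e * curJ C η S B ω) * normOrd (freeMeasure d N η M2) (pairD C η S lam) ω - C.e * locQ C η S B lam ω
        - (η * C.e) * derQ C η S B lam ω) ∂freeMeasure d N η M2 = 0 :=
  eq226_free_gaussian C η hη hM S B lam (A := ∑ x ∈ T, |lam x|) (m := 0) (pdiffZ_eq_zero_off_window η hT hTS hTS')
    (abs_le_sum_of_support hT)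

end Literature.MathematicalPhysics.QuantumFieldTheory.Balaban1983to89.B3WT226FreeGaussian

end
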